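import Mathlib
import HarnessLib
import Summits.CriticalPhenomena.CardyFormulaZ2.Theses.CardySelfDualSegment
import Literature.Probability.Percolation.CornerPercolation
import Summits.CriticalPhenomena.CardyFormulaZ2.Theorems.CardySelfDualSegmentSegmentOpenStubGoodSetNhdsZeroOfJets
import Summits.CriticalPhenomena.CardyFormulaZ2.Theorems.CardySelfDualSegmentSegmentOpenStubVitaliJets
import Summits.CriticalPhenomena.CardyFormulaZ2.Theorems.CardySelfDualSegmentSegmentOpenStubShearCrossRatioAnalytic
import Summits.CriticalPhenomena.CardyFormulaZ2.Theorems.CardySelfDualSegmentSegmentOpenStubCrossingProbPolynomial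
import Summits.CriticalPhenomena.CardyFormulaZ2.Theorems.CardySelfDualSegmentUniformMarginalityWildFromRectilinear

/-!
# Child `NearSmirnov` of the r1 split of crux `SegmentOpen` (stmt-CriticalPhenomena-5471) — birth skeleton (plan)

Strategist r1 (`planner-cstrat-stmt-CriticalPhenomena-5471-r1-0`, 2026-08-17).  `NearSmirnov` = "a right-neighbourhood
of the Smirnov point is good": `∃ ε > 0, ∀ t < ε, ∃ α ∈ ℍ, CardyMod t α` — PERTURBATIVE linear universality of the
corner family at the ONE solved point `t = 0` (site-𝕋).  Plan = the LOCAL-AT-ZERO slice of line `Sketch`: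

* `stub_localComplexBoundRectAtZero` (research; S4wR AT `t₀ = 0` ONLY, with one complex radius `r` for all
  RECTILINEAR test domains — all-orders marginality⁺ of the self-dual deformation of site-𝕋; Lee–Yang type;
  exact transfer matrices give radius ≈ 1 on boxes, Disproof.lean Numerics H ≤ 13);
* `stub_jetConvRect` (research; = JCR of line `Sketch`, verbatim: every Taylor coefficient at 0 of the crossing
  polynomial of a rectilinear `R'` converges as `δ → 0⁺`; `k = 0` Smirnov, `k = 1` = the signed level-1 pivotal sum
  a₁(δ,R′), numerically convergent, Order1Test.md);
* `stub_jetIdentificationRectLocal` (research; JIR of line `Sketch` LOCALISED at 0: one modulus germ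
  `α : [0,r₀) → ℍ` whose sheared Cardy values have the coefficient limits as one-sided jets — NO global analytic
  curve on `[0,1]`, no pinning at `t = 1`);
* composition `NearSmirnov_of` (PROVED): Vitali with jets on the disc `B(0,r)` per rectilinear `R'`
  (`GoodSetNhdsZeroOfJets.tendsto_eval_of_jets`, `stub_vitaliJets` p132875, S1 p97364, S7 p130521) and the landed
  rectilinear-to-wild transport (W) `HeatFlow.cardyLimit_of_rectilinear` (p137344).

Nothing here touches `t = 1` (bond-ℤ²): the piece is strictly short of the summit (BC7 probe CLEAN, bc/BC7_children.out).
-/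

noncomputable section

namespace Summit.CriticalPhenomena.CardyFormulaZ2.Theses.CardySelfDualSegment

/-- child 1 (crux) of the r1 split of `SegmentOpen` (as the gate would render it). -/
def NearSmirnov : Prop :=
  let prm : unitInterval → Literature.Probability.LatticeModels.Site 2 × Fin 2 → unitInterval := fun t i => if i.2 = 0 then Literature.Probability.Percolation.half else Literature.Probability.Percolation.half * t; let cfg : Set (Literature.Probability.LatticeModels.Site 2 × Fin 2) → Literature.Probability.Percolation.BondConfig (Literature.Probability.LatticeModels.Site 2) := fun S => {e | ∃ v : Literature.Probability.LatticeModels.Site 2, (e = s(v, v + ![1, 0]) ∧ (v, (0 : Fin 2)) ∈ S) ∨ (e = s(v, v + ![0, 1]) ∧ ((v, (0 : Fin 2)) ∈ S ↔ (v, (1 : Fin 2)) ∉ S))}; let P : unitInterval → Literature.Probability.RandomPlanarGeometry.ConformalRectangle → ℝ → ℝ := fun t R δ => (Literature.Probability.LatticeModels.prodBernoulli (prm t)).real {S | cfg S ∈ Literature.Probability.Percolation.embDomainCrossing Literature.Probability.LatticeModels.squareLatticeEmbedding.z R.carrier δ (R.arc 0) (R.arc 2)}; let CardyMod : unitInterval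 → ℂ → Prop := fun t α => ∀ (R R' : Literature.Probability.RandomPlanarGeometry.ConformalRectangle) (φ : Literature.Probability.RandomPlanarGeometry.ConformalEquiv UpperHalfPlane.upperHalfPlaneSet R.carrier) (x : Fin 4 → ℝ), R.carrier = Literature.Barriers.CriticalPhenomena.moduliShear α '' R'.carrier → (∀ i, R.pt i = Literature.Barriers.CriticalPhenomena.moduliShear α (R'.pt i)) → R.IsUniformizing φ x → Filter.Tendsto (P t R') (nhdsWithin 0 (Set.Ioi 0)) (nhds (Literature.Probability.RandomPlanarGeometry.cardyFunction (Literature.Probability.RandomPlanarGeometry.crossRatio x))); let G : Set unitInterval := {t | ∃ α : ℂ, 0 < α.im ∧ CardyMod t α}; ∃ ε > 0, ∀ t : unitInterval, (t : ℝ) < ε → t ∈ G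

end Summit.CriticalPhenomena.CardyFormulaZ2.Theses.CardySelfDualSegment

namespace Summit.CriticalPhenomena.CardyFormulaZ2.Cruxes.SegmentOpen.NearSmirnovBirth

open Filter Set Topology
open Literature.Probability Literature.Barriers.CriticalPhenomena
open Literature.Probability.RandomPlanarGeometry (ConformalRectangle ConformalEquiv)
open Summit.CriticalPhenomena.CardyFormulaZ2.Theses.CardySelfDualSegment
open Summit.CriticalPhenomena.CardyFormulaZ2.Theorems

/-! ## Stubs (tree vocabulary only) -/

/-- A0 (research).  UNIFORM-RADIUS LOCAL ANALYTICITY AT THE SMIRNOV POINT ON TAME DOMAINS: there is one complex radius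
`r > 0` such that for every RECTILINEAR conformal rectangle `R` the crossing polynomials `p_δ` of `R` are bounded on
`B(0, r)` by a constant `C(R)`, for all meshes below a threshold `δ₁(R)`.  (S4wR of line `Sketch` at `t₀ = 0` only,
with the radius uniform in `R`; by Cauchy it contains boundedness of every signed level-`k` pivotal sum at `t = 0`.) -/
theorem stub_localComplexBoundRectAtZero :
    ∃ r > 0, ∀ R : ConformalRectangle,
      (∃ S : Finset (ℂ × ℂ), (∀ p ∈ S, p.1.re = p.2.re ∨ p.1.im = p.2.im) ∧
        frontier R.carrier ⊆ ⋃ p ∈ S, segment ℝ p.1 p.2) →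
      ∃ δ₁ > 0, ∃ C : ℝ, ∀ δ : ℝ, 0 < δ → δ < δ₁ → ∀ p : Polynomial ℝ,
        (∀ t : unitInterval, Percolation.cornerCrossingProb t R δ = p.eval (t : ℝ)) →
        ∀ z ∈ Metric.ball (0 : ℂ) r, ‖(p.map (algebraMap ℝ ℂ)).eval z‖ ≤ C := by
  sorry

/-- JCR (research; verbatim the registered stub of line `Sketch`).  JET CONVERGENCE AT THE SMIRNOV POINT ON TAME
DOMAINS. -/
theorem stub_jetConvRect :
    ∀ R' : ConformalRectangle,
      (∃ S : Finset (ℂ × ℂ), (∀ p ∈ S, p.1.re = p.2.re ∨ p.1.im = p.2.im) ∧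
        frontier R'.carrier ⊆ ⋃ p ∈ S, segment ℝ p.1 p.2) →
      ∀ k : ℕ, ∃ a : ℝ, ∀ ε > 0, ∃ δ₀ > 0, ∀ δ : ℝ, 0 < δ → δ < δ₀ → ∀ p : Polynomial ℝ,
        (∀ t : unitInterval, Percolation.cornerCrossingProb t R' δ = p.eval (t : ℝ)) →
        |p.coeff k - a| < ε := by
  sorry

/-- JIR₀ (research; JIR of line `Sketch` LOCALISED at the Smirnov point).  There are `r₀ > 0` and a modulus germ
`α` on `[0, r₀)` with `0 < im α` such that for every RECTILINEAR `R'`, every real-analytic modulus function `M` of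
`R'` (S7) and every sequence `a` of coefficient limits of the crossing polynomials of `R'`, the perturbation series
`Σ a_k t^k` sums to `F(M(α t))` for `t < r₀` ("all-orders conformal perturbation theory AT the Smirnov point",
order 1 = θ′(0)·∂_θF, numerically θ′(0) = 0.3927(27) ≈ π/8, Order1Test.md). -/
theorem stub_jetIdentificationRectLocal :
    ∃ r₀ > 0, ∃ α : unitInterval → ℂ, (∀ t : unitInterval, (t : ℝ) < r₀ → 0 < (α t).im) ∧
      ∀ R' : ConformalRectangle,
        (∃ S : Finset (ℂ × ℂ), (∀ p ∈ S, p.1.re = p.2.re ∨ p.1.im = p.2.im) ∧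
          frontier R'.carrier ⊆ ⋃ p ∈ S, segment ℝ p.1 p.2) →
        ∀ M : ℂ → ℝ, AnalyticOnNhd ℝ M {β : ℂ | 0 < β.im} →
          (∀ β : ℂ, 0 < β.im → ∀ (R : ConformalRectangle)
              (φ : ConformalEquiv UpperHalfPlane.upperHalfPlaneSet R.carrier) (x : Fin 4 → ℝ),
              R.carrier = moduliShear β '' R'.carrier → (∀ i, R.pt i = moduliShear β (R'.pt i)) →
              R.IsUniformizing φ x → RandomPlanarGeometry.crossRatio x = M β) →
          ∀ a : ℕ → ℝ,
            (∀ k : ℕ, ∀ ε > 0, ∃ δ₀ > 0, ∀ δ : ℝ, 0 < δ → δ < δ₀ → ∀ p : Polynomial ℝ,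
                (∀ t : unitInterval, Percolation.cornerCrossingProb t R' δ = p.eval (t : ℝ)) →
                |p.coeff k - a k| < ε) →
            ∀ t : unitInterval, (t : ℝ) < r₀ →
              HasSum (fun k : ℕ => a k * (t : ℝ) ^ k) (RandomPlanarGeometry.cardyFunction (M (α t))) := by
  sorry

/-! ## Composition (proved) -/

/-- `CardyMod t α` of the route over `Percolation.cornerCrossingProb`. -/
abbrev CardyModAt (t : unitInterval) (α : ℂ) : Prop :=
  ∀ (R R' : ConformalRectangle)
    (φ : ConformalEquiv UpperHalfPlane.upperHalfPlaneSet R.carrier) (x : Fin 4 → ℝ),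
    R.carrier = moduliShear α '' R'.carrier → (∀ i, R.pt i = moduliShear α (R'.pt i)) →
    R.IsUniformizing φ x →
    Tendsto (Percolation.cornerCrossingProb t R') (𝓝[>] 0)
      (𝓝 (RandomPlanarGeometry.cardyFunction (RandomPlanarGeometry.crossRatio x)))

theorem nearSmirnov_iff :
    NearSmirnov ↔ ∃ ε > 0, ∀ t : unitInterval, (t : ℝ) < ε → ∃ α : ℂ, 0 < α.im ∧ CardyModAt t α :=
  Iff.rfl

open GoodSetNhdsZeroOfJets in
/-- **COMPOSITION: A0 → JCR → JIR₀ → `NearSmirnov`.**  For `t < min r r₀` and a RECTILINEAR `R'`: S7 gives the modulus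
function `M`, JCR the coefficient limits `a`, JIR₀ their sum `F(M(α t))`, and Vitali-with-jets on `B(0,r)`
(`tendsto_eval_of_jets` with A0's bound) the convergence `P_t(R', δ) → F(M(α t))`; the landed transport (W)
upgrades the rectilinear limits to every conformal rectangle, so `t` is good with modulus `α t`. -/
theorem NearSmirnov_of :
    (∃ r > 0, ∀ R : ConformalRectangle,
      (∃ S : Finset (ℂ × ℂ), (∀ p ∈ S, p.1.re = p.2.re ∨ p.1.im = p.2.im) ∧
        frontier R.carrier ⊆ ⋃ p ∈ S, segment ℝ p.1 p.2) →
      ∃ δ₁ > 0, ∃ C : ℝ, ∀ δ : ℝ, 0 < δ → δ < δ₁ → ∀ p : Polynomial ℝ,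
        (∀ t : unitInterval, Percolation.cornerCrossingProb t R δ = p.eval (t : ℝ)) →
        ∀ z ∈ Metric.ball (0 : ℂ) r, ‖(p.map (algebraMap ℝ ℂ)).eval z‖ ≤ C) →
    (∀ R' : ConformalRectangle,
      (∃ S : Finset (ℂ × ℂ), (∀ p ∈ S, p.1.re = p.2.re ∨ p.1.im = p.2.im) ∧
        frontier R'.carrier ⊆ ⋃ p ∈ S, segment ℝ p.1 p.2) →
      ∀ k : ℕ, ∃ a : ℝ, ∀ ε > 0, ∃ δ₀ > 0, ∀ δ : ℝ, 0 < δ → δ < δ₀ → ∀ p : Polynomial ℝ,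
        (∀ t : unitInterval, Percolation.cornerCrossingProb t R' δ = p.eval (t : ℝ)) →
        |p.coeff k - a| < ε) →
    (∃ r₀ > 0, ∃ α : unitInterval → ℂ, (∀ t : unitInterval, (t : ℝ) < r₀ → 0 < (α t).im) ∧
      ∀ R' : ConformalRectangle,
        (∃ S : Finset (ℂ × ℂ), (∀ p ∈ S, p.1.re = p.2.re ∨ p.1.im = p.2.im) ∧
          frontier R'.carrier ⊆ ⋃ p ∈ S, segment ℝ p.1 p.2) →
        ∀ M : ℂ → ℝ, AnalyticOnNhd ℝ M {β : ℂ | 0 < β.im} →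
          (∀ β : ℂ, 0 < β.im → ∀ (R : ConformalRectangle)
              (φ : ConformalEquiv UpperHalfPlane.upperHalfPlaneSet R.carrier) (x : Fin 4 → ℝ),
              R.carrier = moduliShear β '' R'.carrier → (∀ i, R.pt i = moduliShear β (R'.pt i)) →
              R.IsUniformizing φ x → RandomPlanarGeometry.crossRatio x = M β) →
          ∀ a : ℕ → ℝ,
            (∀ k : ℕ, ∀ ε > 0, ∃ δ₀ > 0, ∀ δ : ℝ, 0 < δ → δ < δ₀ → ∀ p : Polynomial ℝ,
                (∀ t : unitInterval, Percolation.cornerCrossingProb t R' δ = p.eval (t : ℝ)) →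
                |p.coeff k - a k| < ε) →
            ∀ t : unitInterval, (t : ℝ) < r₀ →
              HasSum (fun k : ℕ => a k * (t : ℝ) ^ k) (RandomPlanarGeometry.cardyFunction (M (α t)))) →
    NearSmirnov := by
  classical
  intro h4 hJC hJI
  rw [nearSmirnov_iff]
  obtain ⟨r, hr, hR⟩ := h4
  obtain ⟨r₀, hr₀, α, hα, hJ⟩ := hJI
  refine ⟨min r r₀, lt_min hr hr₀, fun t ht => ?_⟩
  have htr : (t : ℝ) < r := lt_of_lt_of_le ht (min_le_left _ _)
  have htr₀ : (t : ℝ) < r₀ := lt_of_lt_of_le ht (min_le_right _ _)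
  refine ⟨α t, hα t htr₀, ?_⟩
  -- rectilinear test domains first; then the landed rectilinear-to-wild transport (W)
  refine Summit.CriticalPhenomena.CardyFormulaZ2.Cruxes.UniformMarginality.HeatFlow.cardyLimit_of_rectilinear
    t (α t) (hα t htr₀) ?_
  intro R R' φ x hrect hcar hpt hunif
  -- the modulus function of `R'` (S7) and the local Smirnov jet of `R'` (JCR + JIR₀)
  obtain ⟨M, hMan, hM⟩ := stub_shearCrossRatioAnalytic R'
  have hcr : RandomPlanarGeometry.crossRatio x = M (α t) := hM (α t) (hα t htr₀) R φ x hcar hpt hunif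
  choose a ha using hJC R' hrect
  have hsum := hJ R' hrect M hMan hM a ha t htr₀
  -- the uniform bound at `t₀ = 0` for `R'` (A0), crossing polynomials from S1
  obtain ⟨δ₁, hδ₁, C, hC⟩ := hR R' hrect
  set P : ℝ → Polynomial ℝ := fun δ =>
    if h : 0 < δ then Classical.choose (stub_crossingProbPolynomial R' δ h) else 0 with hP
  have hPspec : ∀ δ : ℝ, 0 < δ → ∀ s : unitInterval,
      Percolation.cornerCrossingProb s R' δ = (P δ).eval (s : ℝ) := fun δ hδ => by
    simp only [hP, dif_pos hδ]
    exact Classical.choose_spec (stub_crossingProbPolynomial R' δ hδ)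
  rw [hcr]
  -- reduce to sequences of meshes
  rw [tendsto_iff_seq_tendsto]
  intro d hd
  have key := tendsto_eval_of_jets stub_vitaliJets hr hδ₁ P
    (fun δ hδ hδ' z hz => hC δ hδ hδ' (P δ) (hPspec δ hδ) z hz)
    (fun k ε hε => by
      obtain ⟨δ₀, hδ₀, h⟩ := ha k ε hε
      exact ⟨δ₀, hδ₀, fun δ hδ hδ' => h δ hδ hδ' (P δ) (hPspec δ hδ)⟩)
    (unitInterval.nonneg t) htr hsum hd
  have hgood : ∀ᶠ n in atTop, 0 < d n := by
    have h1 : ∀ᶠ n in atTop, d n ∈ Ioi 0 := hd self_mem_nhdsWithin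
    exact h1.mono fun n hn => hn
  refine key.congr' ?_
  filter_upwards [hgood] with n hn
  exact (hPspec (d n) hn t).symm

/-- The registered-stub form: the three stubs close the child. -/
theorem NearSmirnov_of_stubs : NearSmirnov :=
  NearSmirnov_of stub_localComplexBoundRectAtZero stub_jetConvRect stub_jetIdentificationRectLocal

end Summit.CriticalPhenomena.CardyFormulaZ2.Cruxes.SegmentOpen.NearSmirnovBirth
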